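import Literature.Probability.Percolation.Z2PivotalCampbellLimit
import Literature.Probability.Distributions.JointLawSubseqLimit
import HarnessLib

/-!
# Subsequential joint limits of a bond-`ℤ²` configuration with its averaged pivotal measures

Topic `Literature/Probability/Percolation`; proofs file next to `Z2PivotalMeasure.lean` /
`Z2PivotalMeasureIntegral.lean` / `Z2PivotalCampbellLimit.lean` (Garban–Pete–Schramm's
isometry-averaged normalised `ε`-important measures `μ^ε_δ(ω) = z2PivotalMeasure ε δ ω` of bond
percolation on `δℤ²` at `p = ½`) and to the model-free glue
`Literature/Probability/Distributions/JointLawSubseqLimit.lean`.  No named fact is introduced.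

**The tightness / Prokhorov sub-node of the joint limit** (Garban–Pete–Schramm 2013, Thm. 4.3
and §4.7, asserted for `ℤ²` in §1 p. 10): GPS prove on the triangular lattice that
`(ω_η, μ^ε_η(ω)) ⇒ (ω, μ^ε(ω))` jointly, the limit measure being a measurable FUNCTION of the
limit configuration.  The soft half of this — existence of subsequential joint limit LAWS — holds
for bond-`ℤ²` as soon as the second moments `E[⟨μ^ε_δ, |φ|⟩²]` are bounded uniformly in small `δ`
(the output of the four-arm second-moment estimate, GPS 2013 §4.3–4.6, taken here as the
hypothesis `hmom`), and is what this file proves: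

* `exists_forall_apply_le_of_tendsto_zero` — bookkeeping: a bound for `0 < δ ≤ δ₀` is a bound
  along any mesh sequence `δ_k → 0⁺` (finitely many values remain);
* `tendsto_integral_comp_z2QuadConfig` — `μ_{δ_k} → μ` in `ℋ` read on the percolation space:
  `E g(ω_{δ_k}) → ∫ g dμ` for bounded continuous `g`;
* **`exists_subseq_jointLaw_z2PivotalMeasure`** — for a mesh sequence `δ_k → 0⁺` realising a
  subsequential quad-crossing limit `μ`, COUNTABLY many cutoffs `εᵢ > 0` and test functions
  `φᵢ ∈ C_c(ℂ)`: along a subsequence `ψ`, `(ω_{δ_{ψ k}}, (⟨μ^{εᵢ}_{δ_{ψ k}}(ω), φᵢ⟩)ᵢ)` converges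
  in law on `ℋ × ℝ^ι` (bounded continuous test functions) to a probability law `ν` with first
  marginal `μ` and finite coordinate second moments.  (Schramm–Smirnov Thm. 1.4: `ℋ` is compact
  metrisable, so only the real coordinates need Chebyshev.)

What is NOT here (unprinted for `ℤ²`): that `ν` is supported on a graph — the limit vector is
`(⟨M εᵢ S, φᵢ⟩)ᵢ` for a measurable kernel `M` (GPS 2013 Prop. 4.1/4.5, Lemma 4.6: ratio-limit
and coupling arguments) — which is what upgrades this to the joint limit `IsZ2PivotalKernelLimit`
consumed by the route `Summits/CriticalPhenomena/CardyFormulaZ2/Theses/CardyMeckeFlip` (crux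
`FlipErgodicityZ2`, stub `stub_jointKernelLimit`).

## References

* C. Garban, G. Pete, O. Schramm, *Pivotal, cluster and interface measures for critical planar
  percolation*, JAMS 26 (2013), arXiv:1008.1378, Thm. 4.3, §4.3–4.7, §1 p. 10.
* O. Schramm, S. Smirnov, Ann. Probab. 39 (2011), Thm. 1.4 (compact metrisable `ℋ`).
* P. Billingsley, *Convergence of Probability Measures*, 2nd ed. (1999), Thms. 5.1–5.2.
-/

noncomputable section

open Set Filter Metric
open _root_.MeasureTheory _root_.Topology
open scoped ENNReal BoundedContinuousFunction

namespace Literature.Probability.Percolation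

open QuadCrossing LatticeModels Literature.Probability.Distributions

/-- **Bounds for small `δ` are bounds along a mesh sequence.**  If `f δ ≤ C` for
`0 < δ ≤ δ₀` and `δ_k → 0⁺` (all `δ_k > 0`), then `sup_k f(δ_k) < ∞`: eventually `δ_k < δ₀`, and
finitely many (real) values remain.  Used with `f δ = E[⟨μ^ε_δ, |φ|⟩²]`, the uniform second
moments of the averaged pivotal measures. [folklore] -/
theorem exists_forall_apply_le_of_tendsto_zero {δs : ℕ → ℝ} (hpos : ∀ k, 0 < δs k)
    (h0 : Tendsto δs atTop (𝓝 0)) (f : ℝ → ℝ) {C δ₀ : ℝ} (hδ₀ : 0 < δ₀)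
    (hC : ∀ δ : ℝ, 0 < δ → δ ≤ δ₀ → f δ ≤ C) : ∃ C' : ℝ, ∀ k, f (δs k) ≤ C' := by
  have hev : ∀ᶠ k in atTop, f (δs k) ≤ C := by
    filter_upwards [h0.eventually (eventually_lt_nhds hδ₀)] with k hk
    exact hC (δs k) (hpos k) hk.le
  obtain ⟨C', hC'⟩ := (isBoundedUnder_of_eventually_le hev).bddAbove_range
  exact ⟨C', fun k => hC' (mem_range_self k)⟩

/-- **`μ_{δ_k} → μ` read on the percolation space**: for a mesh sequence of positive meshes with
`z2QuadLaw univ (δ_k) → μ` and a bounded continuous `g : ℋ → ℝ`,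
`E g(ω_{δ_k}) → ∫ g dμ` (the law `μ_δ` is the push-forward of `P_½` under the Borel map
`ω ↦ ω_δ`, `measurable_z2QuadConfig`). [folklore] -/
theorem tendsto_integral_comp_z2QuadConfig {μ : FiniteMeasure (QuadConfig (univ : Set ℂ))}
    {δs : ℕ → ℝ} (hpos : ∀ k, 0 < δs k)
    (hlaw : Tendsto (fun k => z2QuadLaw (univ : Set ℂ) (δs k)) atTop (𝓝 μ))
    (g : QuadConfig (univ : Set ℂ) →ᵇ ℝ) :
    Tendsto (fun k => ∫ ω, g (z2QuadConfig (univ : Set ℂ) (δs k) ω)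
      ∂(bondPercolation (zdGraph 2) half)) atTop
      (𝓝 (∫ S, g S ∂(μ : Measure (QuadConfig (univ : Set ℂ))))) := by
  have h := (FiniteMeasure.tendsto_iff_forall_integral_tendsto.1 hlaw) g
  refine h.congr' (Eventually.of_forall fun k => ?_)
  rw [toMeasure_z2QuadLaw, integral_map (measurable_z2QuadConfig isOpen_univ (hpos k)).aemeasurable
    g.continuous.aestronglyMeasurable]

/-- **Subsequential joint limit in law of a bond-`ℤ²` configuration with the integrals of
countably many test functions against its averaged pivotal measures** (the tightness / Prokhorov
half of Garban–Pete–Schramm 2013 Thm. 4.3 for `ℤ²`).  Assume the uniform second moments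
`sup_{0<δ≤δ₀} E[⟨μ^ε_δ, |φ|⟩²] < ∞` for every cutoff `ε > 0` and every `φ ∈ C_c(ℂ)`.  Let
`δ_k → 0⁺` realise a subsequential quad-crossing limit `μ` on `ℋ = QuadConfig univ`, and fix
countably many cutoffs `εᵢ > 0` and test functions `φᵢ ∈ C_c(ℂ)`.  Then along some subsequence
`ψ` the random elements `(ω_{δ_{ψ k}}, (⟨μ^{εᵢ}_{δ_{ψ k}}(ω), φᵢ⟩)ᵢ)` of `ℋ × (ι → ℝ)` converge
in law — against every bounded continuous `G` — to a probability law `ν` whose first marginal is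
`μ` and whose coordinates have finite second moments.  (`ℋ` is compact metrisable by
Schramm–Smirnov Thm. 1.4, `|⟨μ^ε_δ, φ⟩| ≤ ⟨μ^ε_δ, |φ|⟩` feeds Chebyshev in each coordinate,
then `exists_subseq_tendsto_pair_law`.) [folklore] -/
theorem exists_subseq_jointLaw_z2PivotalMeasure
    (hmom : ∀ ε : ℝ, 0 < ε → ∀ φ : ℂ → ℝ, Continuous φ → HasCompactSupport φ →
      ∃ C δ₀ : ℝ, 0 < δ₀ ∧ ∀ δ : ℝ, 0 < δ → δ ≤ δ₀ →
        ∫ ω, (∫ x, |φ x| ∂(z2PivotalMeasure ε δ ω)) ^ 2 ∂(bondPercolation (zdGraph 2) half) ≤ C)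
    (μ : FiniteMeasure (QuadConfig (univ : Set ℂ))) {δs : ℕ → ℝ} (hpos : ∀ k, 0 < δs k)
    (h0 : Tendsto δs atTop (𝓝 0))
    (hlaw : Tendsto (fun k => z2QuadLaw (univ : Set ℂ) (δs k)) atTop (𝓝 μ))
    {ι : Type*} [Countable ι] {ε : ι → ℝ} (hε : ∀ i, 0 < ε i) {φ : ι → ℂ → ℝ}
    (hφ : ∀ i, Continuous (φ i)) (hφc : ∀ i, HasCompactSupport (φ i)) :
    ∃ ψ : ℕ → ℕ, StrictMono ψ ∧
      ∃ ν : Measure (QuadConfig (univ : Set ℂ) × (ι → ℝ)), IsProbabilityMeasure ν ∧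
        ν.fst = (μ : Measure (QuadConfig (univ : Set ℂ))) ∧
        (∀ i, ∃ C : ℝ, ∫⁻ p, ENNReal.ofReal ((p.2 i) ^ 2) ∂ν ≤ ENNReal.ofReal C) ∧
        ∀ G : (QuadConfig (univ : Set ℂ) × (ι → ℝ)) →ᵇ ℝ,
          Tendsto (fun k => ∫ ω, G (z2QuadConfig (univ : Set ℂ) (δs (ψ k)) ω,
              fun i => ∫ x, φ i x ∂(z2PivotalMeasure (ε i) (δs (ψ k)) ω))
            ∂(bondPercolation (zdGraph 2) half)) atTop (𝓝 (∫ p, G p ∂ν)) := by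
  -- `ℋ` is compact metrisable (Schramm–Smirnov Thm. 1.4), `P_½` is a probability measure
  haveI : T2Space (QuadConfig (univ : Set ℂ)) :=
    (SchrammSmirnov2011_thm_1_4_holds univ isOpen_univ univ_nonempty).1.2.2
  haveI : CompactSpace (QuadConfig (univ : Set ℂ)) := QuadConfig.compactSpace
  haveI : TopologicalSpace.MetrizableSpace (QuadConfig (univ : Set ℂ)) :=
    (SchrammSmirnov2011_thm_1_4_holds univ isOpen_univ univ_nonempty).1.2.1
  haveI : TopologicalSpace.SeparableSpace (QuadConfig (univ : Set ℂ)) := by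
    letI := TopologicalSpace.metrizableSpaceMetric (QuadConfig (univ : Set ℂ))
    infer_instance
  haveI : IsProbabilityMeasure (bondPercolation (zdGraph 2) half) := by
    unfold bondPercolation; infer_instance
  -- the random elements `ω_{δ_k}` and `(⟨μ^{εᵢ}_{δ_k}(ω), φᵢ⟩)ᵢ` are measurable
  have hXm : ∀ k, Measurable (z2QuadConfig (univ : Set ℂ) (δs k)) := fun k =>
    measurable_z2QuadConfig isOpen_univ (hpos k)
  have hvm : ∀ k, Measurable fun (ω : BondConfig (Site 2)) (i : ι) =>
      ∫ x, φ i x ∂(z2PivotalMeasure (ε i) (δs k) ω) := fun k =>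
    measurable_pi_lambda _ fun i =>
      measurable_integral_z2PivotalMeasure (hε i) (hpos k) (hφ i) (hφc i)
  -- tightness inputs: compact first factor, Chebyshev in each coordinate
  have hXt : IsTightMeasureSet (Set.range fun k =>
      (bondPercolation (zdGraph 2) half).map (z2QuadConfig (univ : Set ℂ) (δs k))) :=
    IsTightMeasureSet.of_compactSpace
  have hmomv : ∀ i, ∃ C : ℝ, ∀ k,
      ∫⁻ ω, ENNReal.ofReal ((∫ x, φ i x ∂(z2PivotalMeasure (ε i) (δs k) ω)) ^ 2)
        ∂(bondPercolation (zdGraph 2) half) ≤ ENNReal.ofReal C := by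
    intro i
    obtain ⟨C, δ₀, hδ₀, hC⟩ := hmom (ε i) (hε i) (φ i) (hφ i) (hφc i)
    obtain ⟨C', hC'⟩ := exists_forall_apply_le_of_tendsto_zero hpos h0
      (fun δ => ∫ ω, (∫ x, |φ i x| ∂(z2PivotalMeasure (ε i) δ ω)) ^ 2
        ∂(bondPercolation (zdGraph 2) half)) hδ₀ hC
    have hφa : Continuous fun x => |φ i x| := (hφ i).abs
    have hφca : HasCompactSupport fun x => |φ i x| := (hφc i).abs
    refine ⟨C', fun k => ?_⟩
    exact lintegral_ofReal_sq_le_of_abs_le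
      (t := fun ω => ∫ x, φ i x ∂(z2PivotalMeasure (ε i) (δs k) ω))
      (s := fun ω => ∫ x, |φ i x| ∂(z2PivotalMeasure (ε i) (δs k) ω))
      (fun ω => abs_integral_le_integral_abs)
      (integrable_sq_integral_z2PivotalMeasure (hε i) (hpos k) hφa hφca) (hC' k)
  -- Prokhorov (the model-free package)
  obtain ⟨ψ, hψ, ν, hν, hνmom, hconv⟩ := exists_subseq_tendsto_pair_law
    (X := fun k => z2QuadConfig (univ : Set ℂ) (δs k))
    (v := fun k (ω : BondConfig (Site 2)) (i : ι) => ∫ x, φ i x ∂(z2PivotalMeasure (ε i) (δs k) ω))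
    hXm hvm hXt hmomv
  refine ⟨ψ, hψ, ν, hν, ?_, hνmom, hconv⟩
  -- the first marginal is `μ`
  haveI : IsFiniteMeasure ν := inferInstance
  exact fst_eq_of_tendsto_pair_law hconv fun g =>
    (tendsto_integral_comp_z2QuadConfig hpos hlaw g).comp hψ.tendsto_atTop

end Literature.Probability.Percolation

end
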